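import Summits.QuantumFields.YangMills.Theorems.PoincareLipschitzCovariantDirichlet
import Summits.QuantumFields.YangMills.Theorems.PoincareLipschitzCovariantDirichletSup
import HarnessLib

/-!
# Line «poincare_lipschitz» on crux `HistoryTailL` (stmt-QuantumFields-19936), route crux `BlockLipschitzL` (stmt-QuantumFields-23533), K2 supplier plan,
# (R3)-COV — THE COVARIANT SOURCED INTERIOR MEAN-VALUE ESTIMATE ON `ℤ^d`, GENUINELY COVARIANT, FLAT CONSTANTS:
# `(Σ_μ D*_μD_μ + κ)u = Σ_μ D*_μ g_μ` on `Q_R(x₀)`, `‖g_μ‖ ≤ m` on `Q_{R+1}(x₀)` ⟹ `‖u(x₀)‖² ≤ 4K·Σ_{Q_R(x₀)}‖u‖² + (4K(2R+1)^d + 2)·D²`,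
# `K = 16(336·d·2^d)^d/R^d`, `D = 64·2^d·d·m·(2R+1)` — the (V, τ)-twin of ✓`Prop7FlatSourcedMeanValue.sq_le_of_lop_eq_dvg`

Cell `ym3-torus` (YM ladder rung R3 = continuum SU(2) Yang–Mills on the three-torus — a RUNG, NOT the Clay problem: not d = 4, not infinite volume, not a
mass gap); width seat `ym3-torus-px7` gen 4 («COV-SOURCED-MV», ★w5-19936 g11's first refusal to px7, bus 2026-08-29T01:35Z; LEAD ym-ust-19936-w1 g7's covariant
road, card v1.29/v1.30).  THEOREMS ONLY (def-free); letters of ✓`PoincareLipschitzCovariantCaccioppoli` (p685881) = ✓`PoincareLipschitzCovariantDirichlet`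
(★w5 g11, p686449): `V` a real inner-product space, `τ : Fin d → ℤ^d → (V ≃ₗᵢ[ℝ] V)`; `--supports stmt-QuantumFields-23533`.  Nothing here proves the (R3)-COV
row for 1-forms, `hStab`, F5/F6, a stub, `BlockLipschitzL`, `HistoryTailL` or a summit statement.

PROOF (the flat one, ✓`sq_le_of_lop_eq_dvg`, line by line).  Harmonic replacement `u = h + w` on `Q_R(x₀)` (★w5's ✓`exists_cov_harmonic_replacement`); `w = 0` off
the box and — by ✓`covLop_sub` — `(ΣD*D+κ)w = ΣD*g` on it, so `‖w‖ ≤ D` everywhere (px7's ✓`PoincareLipschitzCovariantDirichletSup.norm_le_of_covDirichlet`, vector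
Stampacchia); `h` is covariantly `κ`-harmonic on `Q_R(x₀)`, so `‖h(x₀)‖² ≤ K·Σ_{Q_R}‖h‖²` (★w5's ✓`normSq_le_of_covHarmonic`, Kato + flat De Giorgi); finally
`‖u‖² ≤ 2‖h‖² + 2‖w‖²`, `Σ_{Q_R}‖h‖² ≤ 2Σ‖u‖² + 2(2R+1)^d D²`.  NO hypothesis on the connection; the constants are the flat ones.

* ★★ `normSq_le_of_covSourced` — the title (`d ≥ 1`, `R ≥ 4`, `κ ≥ 0`, `m ≥ 0`, `V` finite-dimensional).
WHAT REMAINS for the (R3)-COV ROW of card v1.28 (c) (1-forms): ★w5 g11's (W1) covariant Weitzenböck-in-letters (`(ΣD*D)(Y·μ) = ΣD*G_μ + E_μ`,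
`‖G_μ‖ ≤ κ+δ`, `‖E_μ‖ ≤ (d−1)θ·‖Y‖` = the curvature term) and (W2) covariant antiderivative (`E_μ = ΣD* g₀`, `‖g₀‖ ≤ (2R+1)·sup‖E_μ‖`), then the 1-form knit =
this theorem with `g := G + g₀` — carrying the located `R²θ·sup‖Y‖` slot (LOCATE (R3)-LIN v2 §9). [folklore]
-/

set_option autoImplicit false

noncomputable section

open scoped BigOperators
open Finset

namespace Summit.QuantumFields.YangMills.Theorems.PoincareLipschitzCovariantSourcedMeanValue

open Literature.MathematicalPhysics.QuantumFieldTheory.Balaban1983to89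
open B4Eq19LatticeOperators
open Summit.QuantumFields.YangMills.Theorems.PoincareLipschitzCovariantDirichlet (covLop_sub exists_cov_harmonic_replacement normSq_le_of_covHarmonic)
open Summit.QuantumFields.YangMills.Theorems.PoincareLipschitzCovariantDirichletSup (norm_le_of_covDirichlet)

variable {d : ℕ} {V : Type*} [NormedAddCommGroup V] [InnerProductSpace ℝ V]

/-- ★★ **THE COVARIANT SOURCED INTERIOR MEAN-VALUE ESTIMATE.**  `V` finite-dimensional, any connection by linear isometries `τ`; `d ≥ 1`, `R ≥ 4`, `κ ≥ 0`,
`m ≥ 0`; if `(Σ_μ D*_μD_μ + κ)u = Σ_μ D*_μ g_μ` at every site of `Q_R(x₀)` and `‖g_μ(y)‖ ≤ m` for `y ∈ Q_{R+1}(x₀)`, then with `K = 16(336·d·2^d)^d/R^d` and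
`D = 64·2^d·d·m·(2R+1)`: `‖u(x₀)‖² ≤ 4K·Σ_{y ∈ Q_R(x₀)} ‖u(y)‖² + (4K(2R+1)^d + 2)·D²` — i.e. `sup² ≲_d R^{−d}·mass + R²m²`, the flat constants, NO smallness of
the connection. [folklore] [cite: Giaquinta1984, Ch. III §2 (2.5) p.78; Balaban1984PropagatorsII, (1.9) p.226] -/
theorem normSq_le_of_covSourced [FiniteDimensional ℝ V] (hd : 1 ≤ d) (τ : Fin d → Zd d → (V ≃ₗᵢ[ℝ] V)) {κ : ℝ} (hκ : 0 ≤ κ)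
    (u : Zd d → V) (g : Zd d → Fin d → V) (x₀ : Zd d) {R : ℤ} (hR : 4 ≤ R) {m : ℝ} (hm : 0 ≤ m)
    (hEq : ∀ y ∈ box x₀ R, (∑ μ, ((u y + u y) - (τ μ (y - unitVec μ)).symm (u (y - unitVec μ)) - τ μ y (u (y + unitVec μ)))) + κ • u y =
      ∑ μ, ((τ μ (y - unitVec μ)).symm (g (y - unitVec μ) μ) - g y μ))
    (hg : ∀ y ∈ box x₀ (R + 1), ∀ μ, ‖g y μ‖ ≤ m) :
    ‖u x₀‖ ^ 2 ≤ 4 * (16 * (336 * (d : ℝ) * (2 : ℝ) ^ d) ^ d / (R : ℝ) ^ d) * ∑ y ∈ box x₀ R, ‖u y‖ ^ 2 +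
      (4 * (16 * (336 * (d : ℝ) * (2 : ℝ) ^ d) ^ d / (R : ℝ) ^ d) * (2 * (R : ℝ) + 1) ^ d + 2) *
        (64 * (2 : ℝ) ^ d * d * m * (2 * (R : ℝ) + 1)) ^ 2 := by
  classical
  have hd0 : 0 < d := hd
  have hR0 : (0 : ℤ) ≤ R := by linarith
  -- harmonic replacement on the box
  obtain ⟨h, w, hu, hw0, hh, -⟩ := exists_cov_harmonic_replacement hd0 τ hκ u g x₀ R hEq
  -- the corrector solves the sourced equation on the box
  have hwfun : w = fun y => u y - h y := by funext y; rw [hu y]; abel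
  have hwEq : ∀ y ∈ box x₀ R, (∑ μ, ((w y + w y) - (τ μ (y - unitVec μ)).symm (w (y - unitVec μ)) - τ μ y (w (y + unitVec μ)))) + κ • w y =
      ∑ μ, ((τ μ (y - unitVec μ)).symm (g (y - unitVec μ) μ) - g y μ) := by
    intro y hy
    rw [hwfun]
    have e := covLop_sub τ κ u h y
    rw [e, hEq y hy, hh y hy, sub_zero]
  -- the corrector is bounded
  set D : ℝ := 64 * (2 : ℝ) ^ d * d * m * (2 * (R : ℝ) + 1) with hD
  have hwD : ∀ y, ‖w y‖ ≤ D := fun y => norm_le_of_covDirichlet hd τ hκ hR0 g hm hw0 hwEq hg y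
  have hD0 : 0 ≤ D := (norm_nonneg _).trans (hwD x₀)
  -- the harmonic part obeys the covariant mean-value bound
  set K : ℝ := 16 * (336 * (d : ℝ) * (2 : ℝ) ^ d) ^ d / (R : ℝ) ^ d with hK
  have hK0 : 0 ≤ K := by
    rw [hK]
    have : (0 : ℝ) < R := by exact_mod_cast (show (0 : ℤ) < R by linarith)
    positivity
  have hhMV : ‖h x₀‖ ^ 2 ≤ K * ∑ y ∈ box x₀ R, ‖h y‖ ^ 2 := normSq_le_of_covHarmonic hd τ hκ h x₀ hR hh
  -- `‖u‖² ≤ 2‖h‖² + 2‖w‖²` at `x₀`, `‖h‖² ≤ 2‖u‖² + 2D²` on the box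
  have hsplit : ∀ y, ‖u y‖ ^ 2 ≤ 2 * ‖h y‖ ^ 2 + 2 * ‖w y‖ ^ 2 := by
    intro y
    rw [hu y]
    have h1 : ‖h y + w y‖ ≤ ‖h y‖ + ‖w y‖ := norm_add_le _ _
    have h2 : 0 ≤ ‖h y + w y‖ := norm_nonneg _
    nlinarith [sq_nonneg (‖h y‖ - ‖w y‖)]
  have hsplit' : ∀ y, ‖h y‖ ^ 2 ≤ 2 * ‖u y‖ ^ 2 + 2 * D ^ 2 := by
    intro y
    have e : h y = u y - w y := by rw [hu y]; abel
    rw [e]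
    have h1 : ‖u y - w y‖ ≤ ‖u y‖ + ‖w y‖ := norm_sub_le _ _
    have h2 : 0 ≤ ‖u y - w y‖ := norm_nonneg _
    have h3 := hwD y
    have h4 : 0 ≤ ‖w y‖ := norm_nonneg _
    nlinarith [sq_nonneg (‖u y‖ - ‖w y‖)]
  have hcard : ((box x₀ R).card : ℝ) = (2 * (R : ℝ) + 1) ^ d := by
    rw [card_box x₀ hR0]; push_cast; ring
  have hsumh : ∑ y ∈ box x₀ R, ‖h y‖ ^ 2 ≤ 2 * ∑ y ∈ box x₀ R, ‖u y‖ ^ 2 + 2 * (2 * (R : ℝ) + 1) ^ d * D ^ 2 := by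
    calc ∑ y ∈ box x₀ R, ‖h y‖ ^ 2 ≤ ∑ y ∈ box x₀ R, (2 * ‖u y‖ ^ 2 + 2 * D ^ 2) := Finset.sum_le_sum fun y _ => hsplit' y
      _ = 2 * ∑ y ∈ box x₀ R, ‖u y‖ ^ 2 + 2 * (2 * (R : ℝ) + 1) ^ d * D ^ 2 := by
          rw [Finset.sum_add_distrib, ← Finset.mul_sum, Finset.sum_const, nsmul_eq_mul, hcard]; ring
  have hwx := hwD x₀
  have hw0' : 0 ≤ ‖w x₀‖ := norm_nonneg _
  calc ‖u x₀‖ ^ 2 ≤ 2 * ‖h x₀‖ ^ 2 + 2 * ‖w x₀‖ ^ 2 := hsplit x₀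
    _ ≤ 2 * (K * ∑ y ∈ box x₀ R, ‖h y‖ ^ 2) + 2 * D ^ 2 := by nlinarith [hhMV]
    _ ≤ 2 * (K * (2 * ∑ y ∈ box x₀ R, ‖u y‖ ^ 2 + 2 * (2 * (R : ℝ) + 1) ^ d * D ^ 2)) + 2 * D ^ 2 := by
        nlinarith [mul_le_mul_of_nonneg_left hsumh hK0]
    _ = 4 * K * ∑ y ∈ box x₀ R, ‖u y‖ ^ 2 + (4 * K * (2 * (R : ℝ) + 1) ^ d + 2) * D ^ 2 := by ring

end Summit.QuantumFields.YangMills.Theorems.PoincareLipschitzCovariantSourcedMeanValue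

end
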